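import Summits.QuantumFields.BalabanUV.Beta.FP.PerfectPropagatorKernel
import Summits.QuantumFields.BalabanUV.Beta.FP.BlockAveragedRemainderAxial
import Summits.QuantumFields.BalabanUV.Beta.FP.BlockAveragedKernelLegs
import Summits.QuantumFields.BalabanUV.Beta.FP.DecimationSecondMoment

/-!
# Road FP (binder row D1), row H′2-IR ∕ IR-1: BLOCK SUMS OF THE PERFECT BF PROPAGATOR AGAINST BAŁABAN's CONTOUR AVERAGES —
# `|(P^{BF}Q_nᵀ)((x,μ),(u,α))| ≤ C·n⁻¹(1 + dist∕n)⁻²`, x-DIFFERENCES `C·n⁻²(1 + dist∕n)⁻³`, THE DOUBLE AVERAGE `C·n⁻²(1+‖u−v‖∞)⁻²`,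
# and (IR-Q at `P^{BF}`) `|R^Q_{BF}| ≤ C·n⁻²`, `|Δ_xR^Q_{BF}| ≤ C·n⁻³` MODULO the displayed coarse-inverse letters of IR-2 (our bookkeeping)

HONEST DEPENDENCY (page 1, mandatory): continuum YM on T⁴ ⇐ BetaPertH ∧ nine spine estimates (0/9 proved); BetaPertH ⇐ (D1) ∧ (D4) ∧
CAP+tail; G-an2-4 gates asym, D1 and NE2/3/4.  HONEST FRAMING (cell contract, verbatim): «discharging `BetaPertH` makes Bałaban's UV
stability UNCONDITIONAL — a real constructive-QFT result; it is NOT the continuum limit and NOT the Clay problem.»  THIS MODULE is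
instantiation bookkeeping: its ONLY analytic inputs are gan24-formalise-leaf-05-g35's kernel-checked H2-P-KER-ASM v1 `FP/PerfectPropagatorKernel`
((K0) `re_PinfKer`, (K1) `norm_KB_le_div_supNorm_cube`, the global `norm_KB_le`) and an3's free-leg letters through this lineage's PART 5
`FP/BlockAveragedKernelLegs` (`letter_free`, `letterDiff_free`), all BY NAME; the averaging is the tree's `AxialComposition.axialAvg`∕`covAvg`
(PART 3 `FP/BlockAveragedKernelAxial`), the remainder composition is PART B `FP/BlockAveragedRemainderAxial`.  It cites nothing, declares no
`def`, mints no `def … : Prop`, has 0 `sorry`.  THE KERNEL OF RECORD HERE is the REAL PART `P^{BF} μ α z := Re (PinfKer μ α z)` at lattice dimension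
`d + 1 = 4` ((K4) «`KB` real, `KB α β (−z) = KB β α z`» is H2-P-KER-ASM v1.1's business — until it lands, read every `P^{BF}` below as `Re PinfKer`;
the Gaussian covariance of a real field is the real part of its Fourier representation, so nothing is lost for the road).  It proves NO estimate of
`G_C = (Q_nP^{BF}Q_nᵀ)⁻¹` (IR-2): §4 is CONDITIONAL on the displayed (G-exp)∕(G-inv) letters.  It discharges NOTHING of `ρ_a` ∕ `hasym` ∕ D1 ∕ `BetaPertH`
by itself; NEVER «G-an2-4 closed»; NOT (CONV-C), NOT D1, NOT the continuum limit, NOT Clay.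

ABSOLUTE RULE (cell charter, verbatim): «No internally-minted statement may enter as a cited fact. Every hypothesis is either
kernel-proved in this package or a verbatim quotation of a PUBLISHED theorem with page reference. The manuscript(s) under audit are NOT
citable for their own disputed steps — they are the thing under adjudication; programme-internal (2001/route/tribunal) claims are never
citable.»

THE ROW (owner d1-p3-g5, `LEAVES-FP.md` H′2-IR ∕ IR-1, R-FP-18 (c); unblocked by KER-ASM v1 (C) p238743): «block sums of `P^{BF}` against Bałaban's
contour averages: `|(P Q_nᵀ)(x,u)| ≤ C n^{3−d}(1 + dist(x, block u)∕n)^{2−d}`, x-differences one power of n better (d = 4 on the road)».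
CONTENT (`Pt = ℤ⁴`, `‖·‖∞ = DyadicShell.supNorm`; `n ≥ 1`).
* §1 `supNorm_contour_eq` — the tree's two sup norms agree on `ℤ⁴`: `B4ContourShift.supNorm z = (DyadicShell.supNorm z : ℝ)` (`‖z‖∞ ≤ ‖z+e_i‖∞+1` is
  `DecimationSecondMoment.supNorm_le_supNorm_add_single`, imported BY NAME after a `dedup.landed` bounce).
* §2 THE PROPAGATOR LETTERS from (K0)(K1) + the global bound + the free leg: (P0) **`abs_Pbf_le`** `|P^{BF} μ α z| ≤ C₀^{BF}∕(‖z‖∞+1)²`,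
  `C₀^{BF} = 4(U₀+c₄+B₀) + (4·CKB 3 + CB0 3)`; (P1) **`abs_Pbf_fwdDiff_le`** `|P^{BF} μ α (z+e_i) − P^{BF} μ α z| ≤ C₁^{BF}∕(‖z‖∞+1)³`,
  `C₁^{BF} = 8(2U₀+2c₄+Bgrad₀) + (31·CKB 3 + 16·CB0 3)` (R-FP-21 (B3)'s (K2′) «trivial corollary of (K1) + the global bound», done here).
* §3 THE ROW: (i) **`abs_PQ_le`** `n·|axialAvg n α (v ↦ P^{BF} μ α (x−v)) u| ≤ 9·531442·C₀^{BF}∕(n·(1+‖x−n•u‖∞∕n)²)`; (ii) **`abs_PQ_fwdDiff_le`**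
  `≤ 27·531442·C₁^{BF}∕(n²(1+‖x−n•u‖∞∕n)³)`; (iii) **`abs_QPQ_le`** (direction diagonal, `covAvg`) `≤ (9·531442)²C₀^{BF}∕(n²(1+‖u−v‖∞)²)`.
* §4 IR-Q AT `P^{BF}` (CONDITIONAL on IR-2's letters, displayed): **`abs_remQ_bf_le`** `|R^Q_{BF}((x,μ),(y,ν))| ≤ C(K,δ)∕n²` and
  **`abs_remQ_bf_sub_le`** (x-differences) — PART B's `abs_remQ_le_exp` ∕ `abs_remQ_sub_le` at (P0)∕(P1).
Unit `b2b-balaban-gan24-formalise-leaf-04` (gen 40; cross-lane idle G-an2-4 swarm leaf seat on road FP), 2026-08-20; journal CLAIM «IR-1» l.22288.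
-/

namespace Summit.QuantumFields.BalabanUV.Beta.FP.BlockAveragedPropagator

open Finset
open scoped BigOperators
open Literature.MathematicalPhysics.QuantumFieldTheory.Balaban1983to89
open Literature.MathematicalPhysics.QuantumFieldTheory.Balaban1983to89.Beta
open Literature.MathematicalPhysics.QuantumFieldTheory.Balaban1983to89.Beta.DyadicShell (Pt supNorm supNorm_le_iff natAbs_le_supNorm
  exists_eq_supNorm supNorm_eq_zero_iff)
open Literature.MathematicalPhysics.QuantumFieldTheory.Balaban1983to89.Beta.GradedBubbles (supNorm_neg)
open Literature.MathematicalPhysics.QuantumFieldTheory.Balaban1983to89.Beta.BubbleTransfer (c4 c4_pos)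
open Literature.MathematicalPhysics.QuantumFieldTheory.Balaban1983to89.Beta.TwoPowerLegs (TwoPower free)
open Literature.MathematicalPhysics.QuantumFieldTheory.Balaban1983to89.Beta.AxialComposition (axialAvg covAvg)
open Literature.MathematicalPhysics.QuantumFieldTheory.LatticeForm (quo)
open Literature.Probability.LatticeModels (latticeGreen)
open Summit.QuantumFields.BalabanUV.Beta.FP.PerfectPropagatorKernel (PinfKer KB CKB CB0 CB0_nonneg re_PinfKer norm_KB_le
  norm_KB_le_div_supNorm_cube)
open Summit.QuantumFields.BalabanUV.Beta.FP.BlockAveragedKernel (letter_nonneg_of_le supNorm_le_supNorm_sub_add)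
open Summit.QuantumFields.BalabanUV.Beta.FP.BlockAveragedKernelLegs (letter_free letterDiff_free)
open Summit.QuantumFields.BalabanUV.Beta.FP.BlockAveragedKernelAxial (abs_contourAvg_le abs_contourAvg_fwdDiff_le abs_covAvg_le_coarse)
open Summit.QuantumFields.BalabanUV.Beta.FP.BlockAveragedRemainderAxial (abs_remQ_le_exp abs_remQ_sub_le)
open Summit.QuantumFields.BalabanUV.Beta.FP.LatticeConvolutionBounds (exp_neg_supNorm_le_div_pow)
open Summit.QuantumFields.BalabanUV.Beta.FP.DecimationSecondMoment (supNorm_le_supNorm_add_single)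

noncomputable section

/-! ## §1 The two sup norms of the tree agree on `ℤ⁴`; unit vectors -/

/-- [folklore] `B4ContourShift.supNorm z = (DyadicShell.supNorm z : ℝ)` for `z : ℤ⁴` (both are `max_i |z_i|`). -/
theorem supNorm_contour_eq (z : Pt) : B4ContourShift.supNorm (d := 3) z = (supNorm z : ℝ) := by
  apply le_antisymm
  · obtain ⟨i, hi⟩ := B4ContourShift.exists_supNorm_eq (d := 3) z
    rw [hi]
    have h := natAbs_le_supNorm z i
    have e : ((|z i| : ℤ) : ℝ) = (((z i).natAbs : ℕ) : ℝ) := by rw [← Int.natCast_natAbs, Int.cast_natCast]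
    rw [e]; exact_mod_cast h
  · obtain ⟨j, hj⟩ := exists_eq_supNorm z
    rw [← hj]
    have h := B4ContourShift.abs_le_supNorm (d := 3) z j
    have e : ((|z j| : ℤ) : ℝ) = (((z j).natAbs : ℕ) : ℝ) := by rw [← Int.natCast_natAbs, Int.cast_natCast]
    rw [← e]; exact h

/-- [folklore] `z ≠ 0 ⟹ 1 ≤ ‖z‖∞`. -/
theorem one_le_supNorm_of_ne_zero {z : Pt} (hz : z ≠ 0) : (1 : ℝ) ≤ (supNorm z : ℝ) := by
  have : supNorm z ≠ 0 := fun h => hz (supNorm_eq_zero_iff.mp h)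
  exact_mod_cast Nat.one_le_iff_ne_zero.mpr this

/-! ## §2 The propagator letters (P0), (P1) -/

/-- [our bookkeeping] `0 ≤ CKB 3` — read off (K1) at `z = e₀`. -/
theorem CKB_three_nonneg : 0 ≤ CKB 3 := by
  have hz : (Pi.single (0 : Fin 4) (1 : ℤ) : Pt) ≠ 0 := by
    intro h; have := congrArg (fun f : Pt => f 0) h; simp at this
  have h := norm_KB_le_div_supNorm_cube (d := 3) le_rfl 0 0 hz
  have hs : B4ContourShift.supNorm (d := 3) (Pi.single (0 : Fin 4) (1 : ℤ) : Pt) = 1 := by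
    rw [supNorm_contour_eq]
    have : supNorm (Pi.single (0 : Fin 4) (1 : ℤ) : Pt) = 1 := by
      apply le_antisymm
      · rw [supNorm_le_iff]; intro j; by_cases hj : j = 0
        · subst hj; simp
        · simp [hj]
      · have := natAbs_le_supNorm (Pi.single (0 : Fin 4) (1 : ℤ) : Pt) 0
        simpa using this
    rw [this]; norm_num
  rw [hs, one_pow, div_one] at h
  exact (norm_nonneg _).trans h

/-- **THE REMAINDER KERNEL's PROFILE LETTER** [our bookkeeping]: `|Re KB μ α z| ≤ (4·CKB 3 + CB0 3)∕(‖z‖∞+1)²` for ALL `z`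
((K1) off the origin with `1∕‖z‖³ ≤ 1∕‖z‖² ≤ 4∕(‖z‖+1)²`, the global bound `CB0` at the origin). -/
theorem abs_reKB_le (μ α : Fin 4) (z : Pt) :
    |(KB (d := 3) μ α z).re| ≤ (4 * CKB 3 + CB0 3) / ((supNorm z : ℝ) + 1) ^ 2 := by
  have hre : |(KB (d := 3) μ α z).re| ≤ ‖KB (d := 3) μ α z‖ := Complex.abs_re_le_norm _
  refine hre.trans ?_
  have hK := CKB_three_nonneg
  have hB := CB0_nonneg 3
  by_cases hz : z = 0
  · subst hz
    rw [supNorm_eq_zero_iff.mpr rfl]; norm_num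
    exact (norm_KB_le (d := 3) μ α 0).trans (by linarith)
  · have h1 := norm_KB_le_div_supNorm_cube (d := 3) le_rfl μ α hz
    rw [supNorm_contour_eq] at h1
    set s : ℝ := (supNorm z : ℝ) with hs
    have hs1 : 1 ≤ s := one_le_supNorm_of_ne_zero hz
    have hs0 : 0 < s := by linarith
    refine h1.trans ?_
    rw [div_le_div_iff₀ (by positivity) (by positivity)]
    -- `CKB·(s+1)² ≤ (4CKB + CB0)·s³`
    nlinarith [mul_nonneg hK (by positivity : (0:ℝ) ≤ s ^ 2 * (s - 1)), mul_nonneg hB (by positivity : (0:ℝ) ≤ s ^ 3),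
      mul_nonneg hK (by positivity : (0:ℝ) ≤ s), mul_nonneg hK hs0.le, sq_nonneg s]

/-- **(P0) THE PROPAGATOR LETTER** [our bookkeeping]: `|Re PinfKer μ α z| ≤ C₀^{BF}∕(‖z‖∞+1)²`, `C₀^{BF} = 4(U₀+c₄+B₀) + (4·CKB 3 + CB0 3)`
(free leg: PART 5 `letter_free`; remainder: `abs_reKB_le`). -/
theorem abs_Pbf_le (μ α : Fin 4) (z : Pt) :
    |(PinfKer (d := 3) μ α z).re| ≤ (4 * (free.U + c4 + free.B) + (4 * CKB 3 + CB0 3)) / ((supNorm z : ℝ) + 1) ^ 2 := by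
  rw [re_PinfKer (d := 3) (by norm_num)]
  have hfree : |(if μ = α then latticeGreen z / 2 else 0)| ≤ 4 * (free.U + c4 + free.B) / ((supNorm z : ℝ) + 1) ^ 2 := by
    split_ifs
    · exact letter_free z
    · rw [abs_zero]; have := free.nonneg_U; have := free.nonneg_B; have := c4_pos.le; positivity
  rw [add_div]
  exact (abs_add_le _ _).trans (add_le_add hfree (abs_reKB_le μ α z))

/-- **THE REMAINDER KERNEL's DIFFERENCE LETTER** [our bookkeeping] (= R-FP-21 (B3)'s (K2′), from (K1) + the global bound):
`|Re KB μ α (z+e_i) − Re KB μ α z| ≤ (31·CKB 3 + 16·CB0 3)∕(‖z‖∞+1)³`. -/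
theorem abs_reKB_fwdDiff_le (μ α i : Fin 4) (z : Pt) :
    |(KB (d := 3) μ α (z + Pi.single i 1)).re - (KB (d := 3) μ α z).re|
      ≤ (31 * CKB 3 + 16 * CB0 3) / ((supNorm z : ℝ) + 1) ^ 3 := by
  have hK := CKB_three_nonneg
  have hB := CB0_nonneg 3
  have htri : |(KB (d := 3) μ α (z + Pi.single i 1)).re - (KB (d := 3) μ α z).re|
      ≤ ‖KB (d := 3) μ α (z + Pi.single i 1)‖ + ‖KB (d := 3) μ α z‖ := by
    rw [← Complex.sub_re]
    refine (Complex.abs_re_le_norm _).trans ((norm_sub_le _ _).trans le_rfl)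
  refine htri.trans ?_
  set s : ℝ := (supNorm z : ℝ) with hs
  have hs0 : 0 ≤ s := Nat.cast_nonneg _
  by_cases hsmall : supNorm z ≤ 1
  · -- both by the global bound; `(s+1)³ ≤ 8`
    have hs1 : s ≤ 1 := by rw [hs]; exact_mod_cast hsmall
    have h1 := norm_KB_le (d := 3) μ α (z + Pi.single i 1)
    have h2 := norm_KB_le (d := 3) μ α z
    have hsum : ‖KB (d := 3) μ α (z + Pi.single i 1)‖ + ‖KB (d := 3) μ α z‖ ≤ 2 * CB0 3 := by linarith
    have hcube : (s + 1) ^ 3 ≤ 8 := by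
      calc (s + 1) ^ 3 ≤ (2 : ℝ) ^ 3 := pow_le_pow_left₀ (by positivity) (by linarith) 3
        _ = 8 := by norm_num
    rw [le_div_iff₀ (by positivity)]
    calc (‖KB (d := 3) μ α (z + Pi.single i 1)‖ + ‖KB (d := 3) μ α z‖) * (s + 1) ^ 3
        ≤ (2 * CB0 3) * 8 := mul_le_mul hsum hcube (by positivity) (by positivity)
      _ = 16 * CB0 3 := by ring
      _ ≤ 31 * CKB 3 + 16 * CB0 3 := by linarith
  · -- both by (K1): `‖z‖ ≥ 2`, `‖z + e‖ ≥ ‖z‖ − 1 ≥ (‖z‖+1)/3`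
    rw [not_le] at hsmall
    have hs2 : 2 ≤ s := by rw [hs]; exact_mod_cast hsmall
    have hz : z ≠ 0 := fun h => by rw [h, supNorm_eq_zero_iff.mpr rfl] at hsmall; omega
    have hze : z + Pi.single i 1 ≠ 0 := by
      intro h
      have := supNorm_le_supNorm_add_single z i
      rw [h, supNorm_eq_zero_iff.mpr rfl] at this; omega
    have h1 := norm_KB_le_div_supNorm_cube (d := 3) le_rfl μ α hze
    have h2 := norm_KB_le_div_supNorm_cube (d := 3) le_rfl μ α hz
    rw [supNorm_contour_eq] at h1 h2
    set s' : ℝ := (supNorm (z + Pi.single i 1) : ℝ) with hs'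
    have hs's : s ≤ s' + 1 := by rw [hs, hs']; exact_mod_cast supNorm_le_supNorm_add_single z i
    have hs'0 : 0 < s' := by linarith
    have hs0' : 0 < s := by linarith
    -- `1/s'^3 ≤ 27/(s+1)^3` and `1/s^3 ≤ 4/(s+1)^3`
    have k1 : CKB 3 / s' ^ 3 ≤ 27 * CKB 3 / (s + 1) ^ 3 := by
      rw [div_le_div_iff₀ (by positivity) (by positivity)]
      have : (s + 1) ^ 3 ≤ 27 * s' ^ 3 := by
        have h3 : s + 1 ≤ 3 * s' := by linarith
        calc (s + 1) ^ 3 ≤ (3 * s') ^ 3 := pow_le_pow_left₀ (by positivity) h3 3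
          _ = 27 * s' ^ 3 := by ring
      nlinarith [mul_nonneg hK (sub_nonneg.mpr this)]
    have k2 : CKB 3 / s ^ 3 ≤ 4 * CKB 3 / (s + 1) ^ 3 := by
      rw [div_le_div_iff₀ (by positivity) (by positivity)]
      have : (s + 1) ^ 3 ≤ 4 * s ^ 3 := by nlinarith [sq_nonneg s, mul_pos hs0' hs0']
      nlinarith [mul_nonneg hK (sub_nonneg.mpr this)]
    calc ‖KB (d := 3) μ α (z + Pi.single i 1)‖ + ‖KB (d := 3) μ α z‖
        ≤ 27 * CKB 3 / (s + 1) ^ 3 + 4 * CKB 3 / (s + 1) ^ 3 := add_le_add (h1.trans k1) (h2.trans k2)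
      _ = 31 * CKB 3 / (s + 1) ^ 3 := by ring
      _ ≤ (31 * CKB 3 + 16 * CB0 3) / (s + 1) ^ 3 := by
          apply div_le_div_of_nonneg_right _ (by positivity); linarith

/-- **(P1) THE PROPAGATOR's DIFFERENCE LETTER** [our bookkeeping]: `|Re PinfKer μ α (z+e_i) − Re PinfKer μ α z| ≤ C₁^{BF}∕(‖z‖∞+1)³`,
`C₁^{BF} = 8(2U₀+2c₄+Bgrad₀) + (31·CKB 3 + 16·CB0 3)` (free leg: PART 5 `letterDiff_free`). -/
theorem abs_Pbf_fwdDiff_le (μ α i : Fin 4) (z : Pt) :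
    |(PinfKer (d := 3) μ α (z + Pi.single i 1)).re - (PinfKer (d := 3) μ α z).re|
      ≤ (8 * (2 * free.U + 2 * c4 + free.Bgrad) + (31 * CKB 3 + 16 * CB0 3)) / ((supNorm z : ℝ) + 1) ^ 3 := by
  rw [re_PinfKer (d := 3) (by norm_num), re_PinfKer (d := 3) (by norm_num)]
  have hfree : |(if μ = α then latticeGreen (z + Pi.single i 1) / 2 else 0) - (if μ = α then latticeGreen z / 2 else 0)|
      ≤ 8 * (2 * free.U + 2 * c4 + free.Bgrad) / ((supNorm z : ℝ) + 1) ^ 3 := by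
    split_ifs
    · exact letterDiff_free i z
    · rw [sub_zero, abs_zero]; have := free.nonneg_U; have := free.Bgrad_nonneg; have := c4_pos.le; positivity
  have e : (if μ = α then latticeGreen (z + Pi.single i 1) / 2 else 0) + (KB (d := 3) μ α (z + Pi.single i 1)).re
      - ((if μ = α then latticeGreen z / 2 else 0) + (KB (d := 3) μ α z).re)
      = ((if μ = α then latticeGreen (z + Pi.single i 1) / 2 else 0) - (if μ = α then latticeGreen z / 2 else 0))
        + ((KB (d := 3) μ α (z + Pi.single i 1)).re - (KB (d := 3) μ α z).re) := by ring
  rw [e, add_div]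
  exact (abs_add_le _ _).trans (add_le_add hfree (abs_reKB_fwdDiff_le μ α i z))

/-! ## §3 The row: (i) `P^{BF}Q_nᵀ`, (ii) its x-differences, (iii) the double average -/

/-- **(i) BLOCK SUMS OF `P^{BF}` AGAINST THE CONTOUR AVERAGE** [our bookkeeping] (the row's `C n^{3−d}(1 + dist∕n)^{2−d}` at `d = 4`, in the owner's
`n·axialAvg` currency; PART 3 `abs_contourAvg_le` at (P0)): for every `n ≥ 1`, all fine bonds `(x,μ)` and coarse bonds `(u,α)`,
`n·|axialAvg n α (v ↦ Re PinfKer μ α (x − v)) u| ≤ 9·531442·C₀^{BF}∕(n·(1 + ‖x − n•u‖∞∕n)²)`. -/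
theorem abs_PQ_le {n : ℕ} (hn : 1 ≤ n) (μ α : Fin 4) (x u : Pt) :
    (n : ℝ) * |axialAvg n α (fun v => (PinfKer (d := 3) μ α (x - v)).re) u|
      ≤ 9 * 531442 * (4 * (free.U + c4 + free.B) + (4 * CKB 3 + CB0 3))
          / ((n : ℝ) * (1 + (supNorm (x - n • u) : ℝ) / n) ^ 2) :=
  abs_contourAvg_le (P := fun z => (PinfKer (d := 3) μ α z).re) (abs_Pbf_le μ α) hn α x u

/-- **(ii) x-DIFFERENCES, ONE POWER OF `n` BETTER** [our bookkeeping] (PART 3 `abs_contourAvg_fwdDiff_le` at (P1)):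
`n·|Δ_i (P^{BF}Q_nᵀ)((x,μ),(u,α))| ≤ 27·531442·C₁^{BF}∕(n²·(1 + ‖x − n•u‖∞∕n)³)`. -/
theorem abs_PQ_fwdDiff_le {n : ℕ} (hn : 1 ≤ n) (μ α i : Fin 4) (x u : Pt) :
    (n : ℝ) * |axialAvg n α (fun v => (PinfKer (d := 3) μ α (x + Pi.single i 1 - v)).re) u
        - axialAvg n α (fun v => (PinfKer (d := 3) μ α (x - v)).re) u|
      ≤ 27 * 531442 * (8 * (2 * free.U + 2 * c4 + free.Bgrad) + (31 * CKB 3 + 16 * CB0 3))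
          / ((n : ℝ) ^ 2 * (1 + (supNorm (x - n • u) : ℝ) / n) ^ 3) :=
  abs_contourAvg_fwdDiff_le (P := fun z => (PinfKer (d := 3) μ α z).re) i (abs_Pbf_fwdDiff_le μ α i) hn α x u

/-- **(iii) THE DOUBLE AVERAGE `Q_nP^{BF}Q_nᵀ` ON THE DIRECTION DIAGONAL** [our bookkeeping] (PART 3 `abs_covAvg_le_coarse` at (P0), `a = 2`):
`|covAvg n α (Re PinfKer μ μ') u v| ≤ (9·531442)²·C₀^{BF}∕(n²·(1 + ‖u − v‖∞)²)`. -/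
theorem abs_QPQ_le {n : ℕ} (hn : 1 ≤ n) (μ μ' α : Fin 4) (u v : Pt) :
    |covAvg n α (fun z => (PinfKer (d := 3) μ μ' z).re) u v|
      ≤ (3 ^ 2 * 531442) ^ 2 * (4 * (free.U + c4 + free.B) + (4 * CKB 3 + CB0 3))
          / ((n : ℝ) ^ 2 * (1 + (supNorm (u - v) : ℝ)) ^ 2) :=
  abs_covAvg_le_coarse (P := fun z => (PinfKer (d := 3) μ μ' z).re) (a := 2) (by norm_num) (abs_Pbf_le μ μ') hn α u v

/-! ## §4 IR-Q at `P^{BF}`: the one-shot remainder MODULO the coarse-inverse letters of IR-2 -/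

/-- **`R^Q_{BF}` IS `O(n⁻²)` UNIFORMLY, MODULO IR-2** [our bookkeeping]: for ANY coarse inverse `G` with the DISPLAYED letters (G-exp)
`|G α β u v| ≤ K·n²·e^{−δ‖u−v‖∞}` and (G-inv) `Σ'_v Σ_β G α β u v·C_n^{BF}((w,ν),(v,β)) = [u = w ∧ α = ν]` against the mass-one coarse covariance
`C_n^{BF}((w,ν),(v,β)) := axialAvg n ν (y′ ↦ axialAvg n β (t ↦ Re PinfKer ν β (y′−t)) v) w` [suppliers: IR-2 (iv)(v)], and all fine bonds,
`|Σ'_u Σ_α (P^{BF}Q_nᵀ)((x,μ),(u,α)) · Σ'_v Σ_β G α β u v·(P^{BF}Q_nᵀ)((y,ν),(v,β))| ≤ C(K,δ)∕n²`, `C(K,δ)` FREE of `n` (PART B `abs_remQ_le_exp`). -/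
theorem abs_remQ_bf_le {n : ℕ} (hn : 1 ≤ n) {G : Fin 4 → Fin 4 → Pt → Pt → ℝ} {K δ : ℝ} (hδ : 0 < δ) (hK : 0 ≤ K)
    (hGexp : ∀ α β u v, |G α β u v| ≤ K * (n : ℝ) ^ 2 * Real.exp (-(δ * supNorm (u - v))))
    (hinv : ∀ (w : Pt) (ν α : Fin 4) (u : Pt), HasSum
      (fun v => ∑ β, G α β u v * axialAvg n ν (fun y' => axialAvg n β (fun t => (PinfKer (d := 3) ν β (y' - t)).re) v) w)
      (if u = w ∧ α = ν then 1 else 0))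
    (μ ν : Fin 4) (x y : Pt) :
    |∑' u, ∑ α, axialAvg n α (fun v => (PinfKer (d := 3) μ α (x - v)).re) u
          * ∑' v, ∑ β, G α β u v * axialAvg n β (fun t => (PinfKer (d := 3) ν β (y - t)).re) v|
        ≤ (4 * 162 * (36 * 531442 * (4 * (free.U + c4 + free.B) + (4 * CKB 3 + CB0 3)))
            * (4 * 1296 * (K * (Real.exp δ * (Nat.factorial 5) / δ ^ 5))
              * (13824 * 531442 * (8 * (2 * free.U + 2 * c4 + free.Bgrad) + (31 * CKB 3 + 16 * CB0 3))) + 1)) / (n : ℝ) ^ 2 :=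
  abs_remQ_le_exp (P := fun μ α z => (PinfKer (d := 3) μ α z).re) hδ hK (fun μ α z => abs_Pbf_le μ α z)
    (fun μ α i z => abs_Pbf_fwdDiff_le μ α i z) hn hGexp hinv μ ν x y

/-- **x-DIFFERENCES OF `R^Q_{BF}` ARE `O(n⁻³)`, MODULO IR-2** [our bookkeeping] (PART B `abs_remQ_sub_le` at (P0)∕(P1), polynomial letter
`κ := K·n²·e^δ·5!∕δ⁵` from (G-exp)). -/
theorem abs_remQ_bf_sub_le {n : ℕ} (hn : 1 ≤ n) {G : Fin 4 → Fin 4 → Pt → Pt → ℝ} {K δ : ℝ} (hδ : 0 < δ) (hK : 0 ≤ K)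
    (hGexp : ∀ α β u v, |G α β u v| ≤ K * (n : ℝ) ^ 2 * Real.exp (-(δ * supNorm (u - v))))
    (hinv : ∀ (w : Pt) (ν α : Fin 4) (u : Pt), HasSum
      (fun v => ∑ β, G α β u v * axialAvg n ν (fun y' => axialAvg n β (fun t => (PinfKer (d := 3) ν β (y' - t)).re) v) w)
      (if u = w ∧ α = ν then 1 else 0))
    (μ ν : Fin 4) (x y : Pt) (i : Fin 4) :
    |(∑' u, ∑ α, axialAvg n α (fun v => (PinfKer (d := 3) μ α (x + Pi.single i 1 - v)).re) u
          * ∑' v, ∑ β, G α β u v * axialAvg n β (fun t => (PinfKer (d := 3) ν β (y - t)).re) v)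
      - (∑' u, ∑ α, axialAvg n α (fun v => (PinfKer (d := 3) μ α (x - v)).re) u
          * ∑' v, ∑ β, G α β u v * axialAvg n β (fun t => (PinfKer (d := 3) ν β (y - t)).re) v)|
        ≤ (Fintype.card (Fin 4) : ℝ) * 162
            * (216 * 531442 * (8 * (2 * free.U + 2 * c4 + free.Bgrad) + (31 * CKB 3 + 16 * CB0 3)) / (n : ℝ) ^ 3)
            * ((Fintype.card (Fin 4) : ℝ) * 1296 * (K * (n : ℝ) ^ 2 * (Real.exp δ * (Nat.factorial 5) / δ ^ 5))
              * (13824 * 531442 * (8 * (2 * free.U + 2 * c4 + free.Bgrad) + (31 * CKB 3 + 16 * CB0 3)) / (n : ℝ) ^ 2) + 1) := by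
  have hn0 : (0 : ℝ) < n := by exact_mod_cast hn
  have hKn : 0 ≤ K * (n : ℝ) ^ 2 := by positivity
  have hGp : ∀ α β u v, |G α β u v|
      ≤ (K * (n : ℝ) ^ 2 * (Real.exp δ * (Nat.factorial 5) / δ ^ 5)) / ((supNorm (u - v) : ℝ) + 1) ^ 5 :=
    fun α β u v => (hGexp α β u v).trans (exp_neg_supNorm_le_div_pow hδ hKn 5 (u - v))
  exact abs_remQ_sub_le (P := fun μ α z => (PinfKer (d := 3) μ α z).re) (fun μ α z => abs_Pbf_le μ α z)
    (fun μ α i z => abs_Pbf_fwdDiff_le μ α i z) hn hGp hinv μ ν x y i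

end

end Summit.QuantumFields.BalabanUV.Beta.FP.BlockAveragedPropagator
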